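import Summits.Ventures.HodgeRepro2.T5SU11SphericalLogConvex

/-!
# The spherical functions of `SU(1,1)` are distinct modulo the Weyl group:
`φ_λ = φ_μ ⟺ μ = λ ∨ μ = 2 − λ`

The functional equation `φ_λ = φ_{2-λ}` (`T5SU11SphericalSymmetry`) says the parameter is determined at
most up to `λ ↦ 2 − λ` (the Weyl group of `SU(1,1)` acting on `λ − ρ`, `ρ = 1`). Conversely, if
`φ_λ = φ_μ` then, writing `a = 1 − |λ − 1| ≤ 1` and `a' = 1 − |μ − 1| ≤ 1` (`φ_λ = φ_a`, `φ_μ = φ_{a'}`,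
`T5SU11SphericalLogConvex.sph_eq_sph_one_sub_abs`) and assuming `a < a'`: Harish-Chandra's asymptotics
give `e^{at} φ_a(a_t) → c(a) > 0` (`T5SU11SphericalAsymptotic.tendsto_exp_mul_sph_hyp`,
`T5SU11SphericalCfun.cfun_pos`), while `e^{at} φ_{a'}(a_t) → 0` — for `a' < 1` since
`e^{a't} φ_{a'}(a_t) → c(a')` and `e^{(a-a')t} → 0`, and for `a' = 1` by the logarithmic estimate
`Ξ(a_t) ≤ 8(1 + t)e^{-t}` (`T5SU11SphericalXiLog.sph_one_hyp_le`): `tendsto_exp_mul_sph_hyp_zero`. The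
limits of the same function must agree, so `c(a) = 0`, a contradiction; hence `a = a'`, i.e.
`|λ − 1| = |μ − 1|`. **`(∀ g, φ_λ(g) = φ_μ(g)) ↔ μ = λ ∨ μ = 2 − λ`** (`sph_eq_sph_iff`), and already on
`A`: `(∀ t, φ_λ(a_t) = φ_μ(a_t)) ↔ μ = λ ∨ μ = 2 − λ` (`sph_hyp_eq_sph_hyp_iff`) — the real-parameter
case of Harish-Chandra's theorem that the spherical functions are parametrised by `𝔞*_ℂ / W`. Nothing is
claimed about (N).

Blind lane: Mathlib + the HodgeRepro2 prefix only; no sorry; axioms ⊆ {propext, Classical.choice,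
Quot.sound}.
-/

namespace Summit.Ventures.HodgeRepro2.T5SU11SphericalInjective

open MeasureTheory Metric Set Filter Topology Complex
open T5SU11Unimodular T5SU11Fibration T5SU11Cartan T5SU11OneParameter T5SU11CartanProjection
  T5HaarCircle T5BergmanCoefficient T5SU11SphericalFunction T5SU11SphericalTwo
  T5SU11SphericalSymmetry T5SU11SphericalBounds T5SU11SphericalContinuous
  T5SU11SphericalAsymptotic T5SU11SphericalLp T5SU11SphericalCfun T5SU11SphericalLpSharp
  T5SU11SphericalXiLog T5SU11SphericalCfunLimit T5SU11SphericalLogConvex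
open scoped Real

/-- `e^{-ct} (1 + t) → 0` as `t → ∞` for `c > 0`. -/
lemma tendsto_exp_neg_mul_mul_one_add {c : ℝ} (hc : 0 < c) :
    Tendsto (fun t : ℝ => Real.exp (-(c * t)) * (1 + t)) atTop (𝓝 0) := by
  have h0 := Real.tendsto_exp_neg_atTop_nhds_zero.comp (tendsto_id.const_mul_atTop hc)
  have h1 := (Real.tendsto_pow_mul_exp_neg_atTop_nhds_zero 1).comp (tendsto_id.const_mul_atTop hc)
  have h := (h0.add (h1.const_mul c⁻¹))
  simp only [Function.comp_def, id_eq, pow_one, mul_zero, add_zero] at h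
  refine h.congr fun t => ?_
  field_simp

section measure

variable [MeasurableSpace Circle] [BorelSpace Circle]

/-- **`e^{at} φ_{a'}(a_t) → 0` for `a < a' ≤ 1`** (the slower-decaying exponent kills the faster
decaying spherical function; at `a' = 1` by the logarithmic estimate). -/
theorem tendsto_exp_mul_sph_hyp_zero {a a' : ℝ} (h : a < a') (h1 : a' ≤ 1) :
    Tendsto (fun t : ℝ => Real.exp (a * t) * sph a' (hyp t)) atTop (𝓝 0) := by
  rcases h1.lt_or_eq with h1 | rfl
  · -- `a' < 1`: `e^{at} φ_{a'} = e^{(a - a') t} · (e^{a' t} φ_{a'}) → 0 · c(a')`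
    have hc : Tendsto (fun t : ℝ => Real.exp ((a - a') * t)) atTop (𝓝 0) := by
      have := Real.tendsto_exp_neg_atTop_nhds_zero.comp (tendsto_id.const_mul_atTop (sub_pos.mpr h))
      refine this.congr fun t => ?_
      simp only [Function.comp_def, id_eq]
      congr 1
      ring
    have := hc.mul (tendsto_exp_mul_sph_hyp h1)
    rw [zero_mul] at this
    refine this.congr fun t => ?_
    rw [← mul_assoc, ← Real.exp_add]
    congr 2
    ring
  · -- `a' = 1`: `0 ≤ e^{at} Ξ(a_t) ≤ 8 (1 + t) e^{(a - 1) t}` for `t ≥ 0`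
    have hlim : Tendsto (fun t : ℝ => 8 * (Real.exp (-((1 - a) * t)) * (1 + t))) atTop (𝓝 0) := by
      have := (tendsto_exp_neg_mul_mul_one_add (sub_pos.mpr h)).const_mul 8
      rwa [mul_zero] at this
    refine tendsto_of_tendsto_of_tendsto_of_le_of_le' tendsto_const_nhds hlim ?_ ?_
    · exact Filter.Eventually.of_forall fun t => mul_nonneg (Real.exp_pos _).le (sph_hyp_pos 1 t).le
    · filter_upwards [Filter.eventually_ge_atTop 0] with t ht
      have hb := sph_one_hyp_le ht
      calc Real.exp (a * t) * sph 1 (hyp t) ≤ Real.exp (a * t) * (8 * (1 + t) * Real.exp (-t)) :=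
            mul_le_mul_of_nonneg_left hb (Real.exp_pos _).le
        _ = 8 * (Real.exp (-((1 - a) * t)) * (1 + t)) := by
            rw [show -((1 - a) * t) = a * t + -t by ring, Real.exp_add]
            ring

/-- **Distinct parameters `a < a' ≤ 1` give distinct functions on `A`.** -/
theorem sph_hyp_ne_of_lt {a a' : ℝ} (h : a < a') (h1 : a' ≤ 1) :
    ¬ ∀ t, sph a (hyp t) = sph a' (hyp t) := by
  intro heq
  have hpos : 0 < cfun a := cfun_pos (lt_of_lt_of_le h h1)
  have t1 := tendsto_exp_mul_sph_hyp (lt_of_lt_of_le h h1)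
  have t2 := tendsto_exp_mul_sph_hyp_zero h h1
  have e : (fun t : ℝ => Real.exp (a * t) * sph a (hyp t)) =
      fun t => Real.exp (a * t) * sph a' (hyp t) := by
    funext t
    rw [heq t]
  rw [e] at t1
  exact hpos.ne' (tendsto_nhds_unique t1 t2)

/-- **`φ_λ = φ_μ` on `A` iff `μ = λ` or `μ = 2 − λ`.** -/
theorem sph_hyp_eq_sph_hyp_iff (lam mu : ℝ) :
    (∀ t, sph lam (hyp t) = sph mu (hyp t)) ↔ mu = lam ∨ mu = 2 - lam := by
  constructor
  · intro h
    have ha : ∀ t, sph (1 - |lam - 1|) (hyp t) = sph (1 - |mu - 1|) (hyp t) := fun t => by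
      rw [← sph_eq_sph_one_sub_abs lam, ← sph_eq_sph_one_sub_abs mu]
      exact h t
    have habs : |lam - 1| = |mu - 1| := by
      by_contra hne
      rcases lt_or_gt_of_ne hne with hlt | hlt
      · exact sph_hyp_ne_of_lt (a := 1 - |mu - 1|) (a' := 1 - |lam - 1|) (by linarith)
          (by linarith [abs_nonneg (lam - 1)]) fun t => (ha t).symm
      · exact sph_hyp_ne_of_lt (a := 1 - |lam - 1|) (a' := 1 - |mu - 1|) (by linarith)
          (by linarith [abs_nonneg (mu - 1)]) ha
    rcases abs_cases (lam - 1) with ⟨h1, _⟩ | ⟨h1, _⟩ <;>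
      rcases abs_cases (mu - 1) with ⟨h2, _⟩ | ⟨h2, _⟩
    · left; linarith
    · right; linarith
    · right; linarith
    · left; linarith
  · rintro (rfl | rfl)
    · intro t; rfl
    · intro t
      exact sph_two_sub_hyp lam t

/-- **The spherical functions are distinct modulo the Weyl group**:
`(∀ g, φ_λ(g) = φ_μ(g)) ↔ μ = λ ∨ μ = 2 − λ`. -/
theorem sph_eq_sph_iff (lam mu : ℝ) : (∀ g, sph lam g = sph mu g) ↔ mu = lam ∨ mu = 2 - lam := by
  constructor
  · intro h
    exact (sph_hyp_eq_sph_hyp_iff lam mu).mp fun t => h (hyp t)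
  · rintro (rfl | rfl)
    · intro g; rfl
    · intro g
      exact sph_two_sub lam g

/-- `φ_λ ≠ φ_μ` as functions when `μ ∉ {λ, 2 − λ}`. -/
theorem sph_ne_sph {lam mu : ℝ} (h1 : mu ≠ lam) (h2 : mu ≠ 2 - lam) : sph lam ≠ sph mu := by
  intro heq
  rcases (sph_eq_sph_iff lam mu).mp (fun g => congrFun heq g) with h | h
  · exact h1 h
  · exact h2 h

end measure

end Summit.Ventures.HodgeRepro2.T5SU11SphericalInjective
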